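import Summits.BirchSwinnertonDyer.BirchSwinnertonDyer.Theorems.ThetaPartnerAtTwoSignedControlAtTwoPlusHondaPointsTwo
import Summits.BirchSwinnertonDyer.BirchSwinnertonDyer.Theorems.ThetaPartnerAtTwoSignedKatoUpToAtTwoLocalTwoModel
import HarnessLib

/-!
# The PLUS tower at `2`, VIII: the generation step along the plus tower FOR THE CURVE `W/ℚ` ITSELF
# (`GoodSS W 2`, `a₂(W) = 0`; no model / torsion / point hypothesis left)
# (K4 `SignedControlAtTwo`, stmt-BirchSwinnertonDyer-20309, line `eulerchar` v6, stub HONDA⁺@2 clause (GEN) — memo LAGPLUS-AT-2 §4)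

Route `ThetaPartnerAtTwo` (TP2; shared with `ResidualThetaTransportAtTwo`), crux K4, lead seat `prover-bsd-wall-tp2-p3` (g2). Capstone of files
I–VII (`SignedEC.PlusTower`): the K3 lead's `…LocalTwoModel` supplies, for `W/ℚ` globally minimal with `GoodSS W 2` and `a₂(W) = 0`, the
`2`-adic model `M_W = (integralModelInt W) ⊗ ℤ₂` with elliptic fibres and `tr = 0`, Kobayashi's tower points `c_m` (`exists_towerPoints_of_goodSS`)
and «no `2`-power torsion in `L(ℚ₂(ζ_{2^m}))`» (`eq_zero_of_two_pow_smul_eq_zero_layer_of_goodSS`); plugging these into file VII gives the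
generation step along the plus tower `ℚ₂(v_{N+1}) ⊃ ℚ₂(v_N)` (`v_L = ζ_{2^L} + ζ_{2^L}⁻¹ − 2`, `N ≥ 2`, i.e. every step `ℚ_{2,n} ⊃ ℚ_{2,n−1}`,
`n ≥ 1`, of the cyclotomic `ℤ₂`-extension of `ℚ₂`) for `W` itself (the integrality instance binder `hintΩ` is discharged by
`isIntegral_genFib_baseChange 2 _`, as in the K3 lead's files).

WHAT. `plusGenStep_of_goodSS`: for `W`, `hss : GoodSS W 2`, `ha : W.frobeniusTrace 2 = 0`, any coordinatewise Galois action `act` on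
`W(ℚ̄₂)` (read on `M_W`), `N ≥ 2`, `ι ∈ Γ` with `ι ζ_{2^{N+2}} = −ζ_{2^{N+2}}⁻¹`, a tower point `c ∈ L(ℚ₂(ζ_{2^{N+1}})) ∩ Ŵ` with `Λ(c) = ℓ_{N+1}`,
and every `P ∈ L(ℚ₂(v_{N+1})) ∩ Ŵ`: there are `B ∈ ℤ[Γ·(c + ι·c)]` and `R ∈ L(ℚ₂(v_{N+1})) ∩ Ŵ` with `P − B − 2•R ∈ L(ℚ₂(v_N)) ∩ Ŵ`.
`exists_plusSystem_of_goodSS`: the ∃-form over all levels with ONE family `c` (the same family for which the K3 lead's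
`…LocalTwoRealTrace.sum_act_add_sum_act_add_mem_two` gives the trace relations of the plus points `c_{N+1} + ι·c_{N+1}`).
This is clause (GEN) of `stub_plusHondaSystemTwo` in `Ω`-currency for the formal-group points; the remaining distance to the stub's
literal text is the dictionary `localLayerPointsOfEmb κ (closureEmb ℚ_v) W n ↔ L(ℚ₂(v_{n+2}))`, `localTraceOfEmb ↔ ∑_q act q̃` (seat w2)
and `E(k)/Ê(k) ≅ W̃(𝔽₂) ≅ ℤ/3` (prime to `2`).
HONEST FRAMING: THEOREMS ONLY (no definition, no named fact, no instance, no `sorry`); local theory at `2`; nothing about any Selmer group;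
closes no item; BSD is not proved by any of this.

References: [Kobayashi2003] §8.4, Prop. 8.7, Lemma 8.9, Props. 8.11–8.12; [KuriharaOtsuki2006] p. 557, Prop. 1.1.
-/

set_option autoImplicit false
-- the Theorems namespace of this sub repeats the summit name by design (D-0017 nested layout)
set_option linter.dupNamespace false

noncomputable section

open scoped Classical Topology NNReal IntermediateField
open Filter PowerSeries Finset Polynomial

namespace Summit.BirchSwinnertonDyer.BirchSwinnertonDyer.Theorems.SignedEC.PlusTower

open Literature.RingTheory.FormalGroups WeierstrassCurve Field Field.absoluteGaloisGroup
open Summit.BirchSwinnertonDyer.Rank1Residual.Additive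
open Summit.BirchSwinnertonDyer.Rank1Residual.Additive.PadicCyclotomicTower
open Summit.BirchSwinnertonDyer.Rank1Residual.Additive.BallEval
open Literature.NumberTheory.EllipticCurves Literature.NumberTheory.EllipticCurves.FormalGroupChart
open Literature.NumberTheory.EllipticCurves.Rank1Residual
open Summit.BirchSwinnertonDyer.BirchSwinnertonDyer.Theorems.SignedKatoOffTwo.LocalAllPrimes
open Summit.BirchSwinnertonDyer.BirchSwinnertonDyer.Theorems.SignedKatoOffTwo.LocalTwo

variable (W : WeierstrassCurve ℚ) [W.IsElliptic] [W.IsGloballyMinimal]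
  [hintΩ : (genFibΩ 2 ((integralModelInt W).map (Int.castRingHom ℤ_[2]))).IsIntegral (Valued.v (R := PadicAlgCl 2)).integer]

/-- **THE GENERATION STEP ALONG THE PLUS TOWER FOR `W` ITSELF** (`GoodSS W 2`, `a₂(W) = 0`, `N ≥ 2`): on the `2`-adic model `M_W`,
for any coordinatewise Galois action, `ι` inverting `ζ_{2^{N+1}}` (normalised by `ι ζ_{2^{N+2}} = −ζ_{2^{N+2}}⁻¹`), a tower point
`c ∈ L(ℚ₂(ζ_{2^{N+1}})) ∩ Ŵ` with `Λ(c) = ℓ_{N+1}`, and every `P ∈ L(ℚ₂(v_{N+1})) ∩ Ŵ`: `P − B − 2•R ∈ L(ℚ₂(v_N)) ∩ Ŵ` for some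
`B ∈ ℤ[Γ·(c + ι·c)]`, `R ∈ L(ℚ₂(v_{N+1})) ∩ Ŵ`. (File VII with the torsion hypothesis discharged by Kobayashi's Prop. 8.7 at `2`.)
[cite: Kobayashi2003, Prop. 8.12] -/
theorem plusGenStep_of_goodSS (hss : GoodSS W 2) (ha : W.frobeniusTrace 2 = 0)
    (act : absoluteGaloisGroup ℚ_[2] → (genFibΩ 2 ((integralModelInt W).map (Int.castRingHom ℤ_[2]))).toAffine.Point →
      (genFibΩ 2 ((integralModelInt W).map (Int.castRingHom ℤ_[2]))).toAffine.Point)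
    (hact0 : ∀ σ, act σ 0 = 0)
    (hact : ∀ σ (x y : PadicAlgCl 2) (h : (genFibΩ 2 ((integralModelInt W).map (Int.castRingHom ℤ_[2]))).toAffine.Nonsingular x y),
      ∃ h', act σ (Affine.Point.some x y h) = Affine.Point.some (σ • x) (σ • y) h')
    {N : ℕ} (hN : 2 ≤ N) {ι : absoluteGaloisGroup ℚ_[2]}
    (hι : toAlgEquiv ℚ_[2] ι (zeta 2 (N + 2)) = zeta 2 (N + 2) ^ (2 ^ (N + 1) + (2 ^ (N + 2) - 1)))
    {c : (genFibΩ 2 ((integralModelInt W).map (Int.castRingHom ℤ_[2]))).toAffine.Point}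
    (hcL : c ∈ subfieldPoints (genFibΩ 2 ((integralModelInt W).map (Int.castRingHom ℤ_[2]))) (layer 2 (N + 1)).toSubfield
      coeffs_mem_layer)
    (hck : c ∈ kernel (Valued.v (R := PadicAlgCl 2)) (genFibΩ 2 ((integralModelInt W).map (Int.castRingHom ℤ_[2]))))
    (hcℓ : ptLogΩ 2 ((integralModelInt W).map (Int.castRingHom ℤ_[2])) c = ell 2 (N + 1))
    {P : (genFibΩ 2 ((integralModelInt W).map (Int.castRingHom ℤ_[2]))).toAffine.Point}
    (hP : P ∈ subfieldPoints (genFibΩ 2 ((integralModelInt W).map (Int.castRingHom ℤ_[2])))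
      (ℚ_[2]⟮zeta 2 (N + 1) + (zeta 2 (N + 1))⁻¹ - 2⟯).toSubfield (coeffs_mem_adjoin _ _))
    (hPk : P ∈ kernel (Valued.v (R := PadicAlgCl 2)) (genFibΩ 2 ((integralModelInt W).map (Int.castRingHom ℤ_[2])))) :
    ∃ B ∈ AddSubgroup.closure (Set.range fun σ : absoluteGaloisGroup ℚ_[2] ↦ act σ (c + act ι c)),
      ∃ R ∈ subfieldPoints (genFibΩ 2 ((integralModelInt W).map (Int.castRingHom ℤ_[2])))
          (ℚ_[2]⟮zeta 2 (N + 1) + (zeta 2 (N + 1))⁻¹ - 2⟯).toSubfield (coeffs_mem_adjoin _ _),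
        R ∈ kernel (Valued.v (R := PadicAlgCl 2)) (genFibΩ 2 ((integralModelInt W).map (Int.castRingHom ℤ_[2]))) ∧
        P - B - 2 • R ∈ subfieldPoints (genFibΩ 2 ((integralModelInt W).map (Int.castRingHom ℤ_[2])))
          (ℚ_[2]⟮zeta 2 N + (zeta 2 N)⁻¹ - 2⟯).toSubfield (coeffs_mem_adjoin _ _) ∧
        P - B - 2 • R ∈ kernel (Valued.v (R := PadicAlgCl 2)) (genFibΩ 2 ((integralModelInt W).map (Int.castRingHom ℤ_[2]))) := by
  haveI := isElliptic_coe_twoAdicModel W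
  haveI := isElliptic_toZMod_twoAdicModel W hss.1
  have htr : Literature.NumberTheory.EllipticCurves.HasseManin.tr
      (((integralModelInt W).map (Int.castRingHom ℤ_[2])).map PadicInt.toZMod) = 0 := by
    rw [tr_twoAdicModel W hss.1, ha]
  exact exists_sub_closure_sub_two_smul_mem_plus' htr act hact0 hact hN
    (fun Q hQ k hk ↦ eq_zero_of_two_pow_smul_eq_zero_layer_of_goodSS W hss (N + 1) hQ hk) hι hcL hck hcℓ hP hPk

/-- **THE PLUS HONDA SYSTEM OF `W` IN `Ω`-CURRENCY, generation half**: for `W` globally minimal with `GoodSS W 2`, `a₂(W) = 0`, and any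
coordinatewise Galois action, there is ONE family `c : ℕ → Ŵ(ℚ̄₂)` of tower points (`c_0 = O`, `c_m ∈ L(ℚ₂(ζ_{2^m})) ∩ Ŵ`, `Λ(c_m) = ℓ_m`;
the K3 lead's `exists_towerPoints_of_goodSS`, whose `Δ`-traces satisfy the trace relations `…LocalTwoRealTrace.sum_act_add_sum_act_add_mem_two`)
such that for EVERY `N ≥ 2` and every `ι` inverting `ζ_{2^{N+1}}` as above, the plus point `e_{N+1} = c_{N+1} + ι·c_{N+1}` lies in
`L(ℚ₂(v_{N+1})) ∩ Ŵ`, has `Λ(e_{N+1}) − v_{N+1} ∈ ℚ₂(v_N)`, and GENERATES: every `P ∈ L(ℚ₂(v_{N+1})) ∩ Ŵ` is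
`B + P' + 2•R` with `B ∈ ℤ[Γ·e_{N+1}]`, `P' ∈ L(ℚ₂(v_N)) ∩ Ŵ`, `R ∈ L(ℚ₂(v_{N+1})) ∩ Ŵ` — the shape of clause (GEN) of
`stub_plusHondaSystemTwo`. [cite: Kobayashi2003, §8.4] -/
theorem exists_plusSystem_of_goodSS (hss : GoodSS W 2) (ha : W.frobeniusTrace 2 = 0)
    (act : absoluteGaloisGroup ℚ_[2] → (genFibΩ 2 ((integralModelInt W).map (Int.castRingHom ℤ_[2]))).toAffine.Point →
      (genFibΩ 2 ((integralModelInt W).map (Int.castRingHom ℤ_[2]))).toAffine.Point)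
    (hact0 : ∀ σ, act σ 0 = 0)
    (hact : ∀ σ (x y : PadicAlgCl 2) (h : (genFibΩ 2 ((integralModelInt W).map (Int.castRingHom ℤ_[2]))).toAffine.Nonsingular x y),
      ∃ h', act σ (Affine.Point.some x y h) = Affine.Point.some (σ • x) (σ • y) h') :
    ∃ c : ℕ → (genFibΩ 2 ((integralModelInt W).map (Int.castRingHom ℤ_[2]))).toAffine.Point, c 0 = 0 ∧
      (∀ m, c m ∈ subfieldPoints (genFibΩ 2 ((integralModelInt W).map (Int.castRingHom ℤ_[2]))) (layer 2 m).toSubfield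
          coeffs_mem_layer ∧
        c m ∈ kernel (Valued.v (R := PadicAlgCl 2)) (genFibΩ 2 ((integralModelInt W).map (Int.castRingHom ℤ_[2]))) ∧
        ptLogΩ 2 ((integralModelInt W).map (Int.castRingHom ℤ_[2])) (c m) = ell 2 m) ∧
      ∀ N : ℕ, 2 ≤ N → ∀ ι : absoluteGaloisGroup ℚ_[2],
        toAlgEquiv ℚ_[2] ι (zeta 2 (N + 2)) = zeta 2 (N + 2) ^ (2 ^ (N + 1) + (2 ^ (N + 2) - 1)) →
        (c (N + 1) + act ι (c (N + 1)) ∈ subfieldPoints (genFibΩ 2 ((integralModelInt W).map (Int.castRingHom ℤ_[2])))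
            (ℚ_[2]⟮zeta 2 (N + 1) + (zeta 2 (N + 1))⁻¹ - 2⟯).toSubfield (coeffs_mem_adjoin _ _) ∧
          c (N + 1) + act ι (c (N + 1)) ∈
            kernel (Valued.v (R := PadicAlgCl 2)) (genFibΩ 2 ((integralModelInt W).map (Int.castRingHom ℤ_[2]))) ∧
          ptLogΩ 2 ((integralModelInt W).map (Int.castRingHom ℤ_[2])) (c (N + 1) + act ι (c (N + 1))) -
            (zeta 2 (N + 1) + (zeta 2 (N + 1))⁻¹ - 2) ∈ ℚ_[2]⟮zeta 2 N + (zeta 2 N)⁻¹ - 2⟯) ∧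
        ∀ P ∈ subfieldPoints (genFibΩ 2 ((integralModelInt W).map (Int.castRingHom ℤ_[2])))
            (ℚ_[2]⟮zeta 2 (N + 1) + (zeta 2 (N + 1))⁻¹ - 2⟯).toSubfield (coeffs_mem_adjoin _ _),
          P ∈ kernel (Valued.v (R := PadicAlgCl 2)) (genFibΩ 2 ((integralModelInt W).map (Int.castRingHom ℤ_[2]))) →
          ∃ B ∈ AddSubgroup.closure (Set.range fun σ : absoluteGaloisGroup ℚ_[2] ↦ act σ (c (N + 1) + act ι (c (N + 1)))),
            ∃ P' ∈ subfieldPoints (genFibΩ 2 ((integralModelInt W).map (Int.castRingHom ℤ_[2])))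
                (ℚ_[2]⟮zeta 2 N + (zeta 2 N)⁻¹ - 2⟯).toSubfield (coeffs_mem_adjoin _ _),
              ∃ R ∈ subfieldPoints (genFibΩ 2 ((integralModelInt W).map (Int.castRingHom ℤ_[2])))
                  (ℚ_[2]⟮zeta 2 (N + 1) + (zeta 2 (N + 1))⁻¹ - 2⟯).toSubfield (coeffs_mem_adjoin _ _),
                P' ∈ kernel (Valued.v (R := PadicAlgCl 2)) (genFibΩ 2 ((integralModelInt W).map (Int.castRingHom ℤ_[2]))) ∧
                R ∈ kernel (Valued.v (R := PadicAlgCl 2)) (genFibΩ 2 ((integralModelInt W).map (Int.castRingHom ℤ_[2]))) ∧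
                P = B + P' + 2 • R := by
  haveI := isElliptic_coe_twoAdicModel W
  haveI := isElliptic_toZMod_twoAdicModel W hss.1
  have htr : Literature.NumberTheory.EllipticCurves.HasseManin.tr
      (((integralModelInt W).map (Int.castRingHom ℤ_[2])).map PadicInt.toZMod) = 0 := by
    rw [tr_twoAdicModel W hss.1, ha]
  obtain ⟨c, hc0, hc⟩ := exists_towerPoints_of_goodSS W hss ha
  refine ⟨c, hc0, hc, fun N hN ι hι ↦ ⟨?_, fun P hP hPk ↦ ?_⟩⟩
  · obtain ⟨hcL, hck, hcℓ⟩ := hc (N + 1)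
    exact plusPoint_mem act hact0 hact hN hι hcL hck hcℓ
  · obtain ⟨hcL, hck, hcℓ⟩ := hc (N + 1)
    obtain ⟨B, hB, R, hRL, hRk, hL, hk⟩ :=
      plusGenStep_of_goodSS W hss ha act hact0 hact hN hι hcL hck hcℓ hP hPk
    exact ⟨B, hB, P - B - 2 • R, hL, R, hRL, hk, hRk, by abel⟩

/-- **The canonical coordinatewise action** `σ ↦ Point.map σ` satisfies the two action axioms used throughout files V–VIII
(`act σ O = O`, `act σ (x, y) = (σx, σy)`), so every `act`-parametrised statement above applies to it (e.g.
`exists_plusSystem_of_goodSS W hss ha _ (pointMap_act_axioms _).1 (pointMap_act_axioms _).2`). [cite: SilvermanAEC2009, VII.2.2] -/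
theorem pointMap_act_axioms (M : WeierstrassCurve ℤ_[2]) :
    (∀ σ : absoluteGaloisGroup ℚ_[2],
        (Affine.Point.map (W' := M.map (PadicInt.Coe.ringHom (p := 2)))
          (toAlgEquiv ℚ_[2] σ : PadicAlgCl 2 →ₐ[ℚ_[2]] PadicAlgCl 2)) (0 : (genFibΩ 2 M).toAffine.Point) = 0) ∧
      ∀ (σ : absoluteGaloisGroup ℚ_[2]) (x y : PadicAlgCl 2) (h : (genFibΩ 2 M).toAffine.Nonsingular x y),
        ∃ h', (Affine.Point.map (W' := M.map (PadicInt.Coe.ringHom (p := 2)))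
            (toAlgEquiv ℚ_[2] σ : PadicAlgCl 2 →ₐ[ℚ_[2]] PadicAlgCl 2)) (Affine.Point.some x y h) =
          Affine.Point.some (σ • x) (σ • y) h' := by
  refine ⟨fun σ ↦ map_zero _, fun σ x y h ↦ ?_⟩
  have h' : (genFibΩ 2 M).toAffine.Nonsingular (toAlgEquiv ℚ_[2] σ x) (toAlgEquiv ℚ_[2] σ y) :=
    (Affine.baseChange_nonsingular (W := (M.map (PadicInt.Coe.ringHom (p := 2))).toAffine)
      (f := (toAlgEquiv ℚ_[2] σ : PadicAlgCl 2 →ₐ[ℚ_[2]] PadicAlgCl 2)) (toAlgEquiv ℚ_[2] σ).injective x y).mpr h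
  refine ⟨by rw [absoluteGaloisGroup.smul_def, absoluteGaloisGroup.smul_def]; exact h', ?_⟩
  rw [Affine.Point.map_some]
  simp only [absoluteGaloisGroup.smul_def]
  rfl

end Summit.BirchSwinnertonDyer.BirchSwinnertonDyer.Theorems.SignedEC.PlusTower

end
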